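import Mathlib
import HarnessLib
import Literature.MathematicalPhysics.QuantumFieldTheory.ConstructiveQFTWave0
import Literature.Barriers.QuantumFields.ElitzurTheorem
import Summits.Ventures.LatticeQCDFlow.Exactness.LatticeCoordAvg
import Summits.Ventures.LatticeQCDFlow.Scaling.WilsonPlaquetteMateCoupling

/-!
# LatticeQCDFlow / Scaling — the Wilson weight genuinely couples plaquette-mates: before any link is
# integrated, the exact conditional of a link reads its plaquette-mate (the `s = ∅` end of the
# gauge-redundancy witness)

HONEST FRAMING: exact (Metropolis-corrected) sampling algorithms for lattice gauge theory;
figures of merit are autocorrelation/cost numbers at stated couplings and volumes; no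
continuum-physics claim.

Venture `LatticeQCDFlow` (cell pub-lqcd), topic `Scaling`, FANOUT row 30 (lean-1, GEN-15/16) — OUR
WORK, sequel of `Scaling/WilsonPlaquetteMateCoupling.lean` (the second difference of `S_W` across the
plaquette-mates `ℓ = (x, i)`, `a = (x + e_j, i)` localises on their unique shared plaquette and is a
square defect of the character; §3 there, `wilsonWeight_not_productForm_mates`: for `L ≥ 3`, `i ≠ j`,
`β ≠ 0`, `Re tr ρ` bounded and not constant the Wilson weight `w = e^{−β S_W}` is NOT a product
`f(U)·g(U)` with `f` blind to `U_ℓ` and `g` blind to `U_a`) and companion of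
`Scaling/AutoregressiveGaugeRedundancyWilson.lean` (THEORY-2.md §4 row C5, gauge case: once the other
links at `x` are integrated, the exact autoregressive conditional of `U_a` does NOT read `U_ℓ`).
Here, with NOTHING integrated (`s = ∅`):

* **`wilson_fullConditional_reads_mate`** — compact `G`, continuous `ρ` with `Re tr ρ` not constant,
  `β ≠ 0`, `L ≥ 3`, `i ≠ j`: the exact conditional density of `U_a` given ALL other links,
  `w / A_{{a}} w` (`A_{{a}}` the one-link Haar average, `Exactness.coordAvg`), takes different values
  at some `U` and `U[ℓ ↦ h]`: at `s = ∅` the plaquette-mate `ℓ` IS in the true context of `a`.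

READING (value-free, with `AutoregressiveGaugeRedundancyWilson`): along the order "`star(x) ∖ {ℓ}`
last, `a` just before them, `ℓ` earlier", the plaquette-mate `ℓ` is in the symbolic context of `a`
AND genuinely coupled to `a` by the weight, yet absent from the true context of `a` — the discrepancy
with C5's "generic Gaussian" heuristic is produced by integrating the `2d − 1` other links at `x`
(gauge redundancy), not by an absent coupling.  NOT CLAIMED: `L = 2`; constant characters (then the
weight couples nothing); any number of ours.  Elementary over the tree; no definition is introduced;
nothing is cited as a fact; no `sorry`.
-/

noncomputable section

namespace Summit.Ventures.LatticeQCDFlow.Theory2.Autoregressive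

open MeasureTheory Function
open Literature.MathematicalPhysics.QuantumFieldTheory
open Summit.Ventures.LatticeQCDFlow.Exactness

variable {d L N : ℕ} {G : Type*} [Group G]

/-! ## §4 At `s = ∅` the plaquette-mate is in the true context -/

section NotProduct

variable (ρ : G →* Matrix (Fin N) (Fin N) ℂ)

variable [TopologicalSpace G] [IsTopologicalGroup G] [CompactSpace G] [MeasurableSpace G]
  [BorelSpace G]

/-- **At `s = ∅` the plaquette-mate IS in the true context.**  Compact `G`, continuous `ρ` with
`Re tr ρ` not constant, `β ≠ 0`, `L ≥ 3`, `i ≠ j`: the exact conditional density of `U_a`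
(`a = (x + e_j, i)`) given ALL other links, `w / A_{{a}} w` (`w = e^{−β S_W}`, `A_{{a}}` the
one-link Haar average, `Exactness.coordAvg`), takes different values at some `U` and `U[ℓ ↦ h]`,
`ℓ = (x, i)` — otherwise `w = (w / A_{{a}} w) · A_{{a}} w` would be a forbidden product
(`wilsonWeight_not_productForm_mates`; `A_{{a}} w > 0` by continuity and compactness). [ours] -/
theorem wilson_fullConditional_reads_mate [NeZero L] (hL : 3 ≤ L) (hρ : Continuous ρ)
    (hnc : ∃ g : G, (ρ g).trace.re ≠ (ρ 1).trace.re) (x : Site d L) {i j : Fin d} (hij : i ≠ j)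
    {β : ℝ} (hβ : β ≠ 0) :
    let w : GaugeConfig d L G → ℝ := fun U => Real.exp (-β * wilsonAction ρ U)
    ∃ (U : GaugeConfig d L G) (h : G),
      w (update U (x, i) h) / coordAvg (haarProbability G) {(x.shift j, i)} w (update U (x, i) h) ≠
        w U / coordAvg (haarProbability G) {(x.shift j, i)} w U := by
  intro w
  by_contra hcon
  push Not at hcon
  obtain ⟨M, -, hM⟩ := Literature.Barriers.QuantumFields.Elitzur.exists_abs_trace_re_le ρ hρ
  refine wilsonWeight_not_productForm_mates ρ hL x hij hβ ⟨M, hM⟩ hnc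
    ⟨fun U => w U / coordAvg (haarProbability G) {(x.shift j, i)} w U,
      coordAvg (haarProbability G) {(x.shift j, i)} w, hcon, fun U h => ?_, fun U => ?_⟩
  · -- the one-link average does not read the averaged link
    rw [show update U (x.shift j, i) h = ({(x.shift j, i)} : Finset (Edge d L)).piecewise (fun _ => h) U
      by rw [Finset.piecewise_singleton]]
    exact coordAvg_apply_piecewise _ _ _ _ _
  · -- `w = (w / m) · m` because the one-link average `m` of the positive continuous weight is positive
    have hwc : Continuous w :=
      Real.continuous_exp.comp (continuous_const.mul
        (Literature.Barriers.QuantumFields.Elitzur.continuous_wilsonAction ρ hρ))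
    have hm : coordAvg (haarProbability G) {(x.shift j, i)} w U =
        ∫ v, w (update U (x.shift j, i) v) ∂haarProbability G := by
      unfold coordAvg
      simp only [Finset.piecewise_singleton]
      have hev := (measurePreserving_eval (fun _ : Edge d L => haarProbability G) (x.shift j, i)).map_eq
      have hc : Continuous fun v : G => w (update U (x.shift j, i) v) :=
        hwc.comp (continuous_const.update _ continuous_id)
      have h1 : ∫ v, w (update U (x.shift j, i) v) ∂haarProbability G =
          ∫ v, w (update U (x.shift j, i) v)
            ∂(Measure.map (eval (x.shift j, i)) (Measure.pi fun _ : Edge d L => haarProbability G)) := by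
        rw [hev]
      rw [h1, integral_map (measurable_pi_apply _).aemeasurable hc.aestronglyMeasurable]
    have hpos : 0 < coordAvg (haarProbability G) {(x.shift j, i)} w U := by
      rw [hm]
      have hc : Continuous fun v : G => -β * wilsonAction ρ (update U (x.shift j, i) v) :=
        continuous_const.mul ((Literature.Barriers.QuantumFields.Elitzur.continuous_wilsonAction ρ
          hρ).comp (continuous_const.update _ continuous_id))
      exact integral_exp_pos ((Real.continuous_exp.comp hc).integrable_of_hasCompactSupport
        (HasCompactSupport.of_compactSpace _))
    simp only
    rw [div_mul_cancel₀ _ hpos.ne']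

end NotProduct

end Summit.Ventures.LatticeQCDFlow.Theory2.Autoregressive

end
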